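import Mathlib.LinearAlgebra.Matrix.NonsingularInverse
import Mathlib.GroupTheory.Index
import Mathlib.Data.ZMod.Basic
import Mathlib.Tactic.FinCases
import Mathlib.Tactic.Abel
import Mathlib.Tactic.NormNum
import HarnessLib

/-!
# The index column `N` of the torus-surgery tables is a lattice index

Companion to `CappellShanesonTorusSurgeryTable*.lean` (Table U: one torus surgery per open class) and `CappellShanesonLandingTuples*.lean`
(Table 18C: one torus per landing tuple) of the bundle `papers/SmoothPoincare4/sp4-gompf-chains` (`EXTENSIONS.md` §§13–19).  Those modules
check, per presenting torus `(b, c_b, k)` with host `A'`, an `index_…` certificate: explicit `v u w ∈ ℤ³`, `a N' ∈ ℤ` with `b ⬝ v = b ⬝ u = 0`,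
`det (v; u; w) = ±1`, `A' v = a v + N' u` (and `(A' − 1) v = ± c_b`), and their docstrings READ this as "`(v, u)` is a basis of `b^⊥ ∩ ℤ³`,
so the circles `S¹_v` and `A' S¹_v` of the torus `T_b = (b^⊥ ⊗ ℝ)/(b^⊥ ∩ ℤ³)` meet algebraically `N = |N'| = [b^⊥ ∩ ℤ³ : ⟨v, A'v⟩]` times".
This module kernel-checks that reading.

1. In general (§1–§2, arbitrary `b v u w A a N'`): if `b ≠ 0`, `b ⬝ v = b ⬝ u = 0` and `det (v; u; w)` is a unit then every `x ∈ ℤ³` with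
   `b ⬝ x = 0` is `p • v + q • u` for a unique `(p, q)` (`perp_coords`, `perp_coords_unique` — `(v, u)` is a `ℤ`-basis of `b^⊥ ∩ ℤ³`);
   if moreover `A v = a • v + N' • u` then `p • v + q • u ∈ ℤv + ℤ(Av) ⟺ N' ∣ q` (`mem_span_iff_dvd`), and the relative index
   `AddSubgroup.relIndex (closure {v, A v}) (b^⊥ ∩ ℤ³)` equals `|N'|` (`relIndex_closure_pair`, via the surjection `x ↦ q(x) mod |N'|` onto
   `ZMod |N'|` with kernel `⟨v, Av⟩`; `index_eq_natAbs` packages it under `det = ±1`).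
2. The sixteen instances (§3): the column `N` of Table U (`N = 7, 23, 3, 23, 5, 5, 7, 41, 29, 5, 7` for the eleven open classes in the order of
   the companion's `open11`) and `N = 3` for the five index-`3` presentations printed in the paper's Remark [Torus surgery], each as the literal
   statement `relIndex (closure {v, A'v}) (perp b) = N` with the companion's data (copied verbatim from `CappellShanesonTorusSurgeryTablePart3.lean`,
   theorems `index_…` / `indexI3_…`, because a staged module cannot be imported before it lands; the hypotheses are re-proved here by `decide`/`simp`).
   The 103 `index_…` certificates of `CappellShanesonLandingTuples*.lean` instantiate `index_eq_natAbs` in exactly the same way.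

What is NOT formalised: that `N` is the algebraic intersection number of the two circles in `T_b` (immediate from the basis statement, but tori are
not modelled here), and anything about 4-manifolds.  Caveat (verbatim from the bundle README): this file was written by an AI system (research harness
seat) and machine-checked by Lean; it has NOT been independently reviewed by a human expert.  Generated 2026-08-19T18:46Z by `gen_t5.py` (bundle
`inputs/t5_gen_t5_g19.py`) from the bundle's scratch module `verify/IndexLattice_g19.lean` (E7) and `t5_rows.json`.
-/

open Matrix

namespace Summit.SmoothPoincare4.GompfChains.CappellShanesonSurgeryIndex

/-! ### 1. Coordinates on `b^⊥ ∩ ℤ³` -/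

/-- The integer matrix with rows `v, u, w` (`= !![v; u; w]`). -/
def rowMat (v u w : Fin 3 → ℤ) : Matrix (Fin 3) (Fin 3) ℤ := Matrix.of ![v, u, w]

/-- Row action of `(v; u; w)`: `c ᵥ* (v; u; w) = c₀ v + c₁ u + c₂ w`. -/
theorem vecMul_rowMat (c v u w : Fin 3 → ℤ) :
    c ᵥ* rowMat v u w = c 0 • v + c 1 • u + c 2 • w := by
  funext j
  simp [rowMat, Matrix.vecMul, dotProduct, Fin.sum_univ_three]

/-- Column action of `(v; u; w)`: `(v; u; w) b = (v ⬝ b, u ⬝ b, w ⬝ b)`. -/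
theorem rowMat_mulVec (b v u w : Fin 3 → ℤ) :
    rowMat v u w *ᵥ b = ![v ⬝ᵥ b, u ⬝ᵥ b, w ⬝ᵥ b] := by
  funext i
  fin_cases i <;> simp [rowMat, Matrix.mulVec]

/-- If `b ≠ 0` is orthogonal to `v` and `u` and `(v; u; w)` is unimodular then `b ⬝ w ≠ 0`. -/
theorem dot_w_ne_zero (b v u w : Fin 3 → ℤ) (hb : b ≠ 0) (hv : b ⬝ᵥ v = 0) (hu : b ⬝ᵥ u = 0)
    (hdet : IsUnit (rowMat v u w).det) : b ⬝ᵥ w ≠ 0 := by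
  intro hw
  apply hb
  have h1 : rowMat v u w *ᵥ b = 0 := by
    rw [rowMat_mulVec, dotProduct_comm v, dotProduct_comm u, dotProduct_comm w, hv, hu, hw]
    funext i; fin_cases i <;> rfl
  have h2 : (rowMat v u w)⁻¹ *ᵥ (rowMat v u w *ᵥ b) = b := by
    rw [Matrix.mulVec_mulVec, Matrix.nonsing_inv_mul _ hdet, Matrix.one_mulVec]
  rw [← h2, h1, Matrix.mulVec_zero]

/-- `(v, u)` spans `b^⊥ ∩ ℤ³`. -/
theorem perp_coords (b v u w : Fin 3 → ℤ) (hb : b ≠ 0) (hv : b ⬝ᵥ v = 0) (hu : b ⬝ᵥ u = 0)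
    (hdet : IsUnit (rowMat v u w).det) (x : Fin 3 → ℤ) (hx : b ⬝ᵥ x = 0) :
    ∃ p q : ℤ, x = p • v + q • u := by
  have hxc : x = (x ᵥ* (rowMat v u w)⁻¹) ᵥ* rowMat v u w := by
    rw [Matrix.vecMul_vecMul, Matrix.nonsing_inv_mul _ hdet, Matrix.vecMul_one]
  set c := x ᵥ* (rowMat v u w)⁻¹ with hc
  have hx' : b ⬝ᵥ x = c 2 * (b ⬝ᵥ w) := by
    rw [dotProduct_comm b x, hxc, ← Matrix.dotProduct_mulVec, rowMat_mulVec, dotProduct_comm v, dotProduct_comm u,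
      dotProduct_comm w, hv, hu]
    simp [dotProduct, Fin.sum_univ_three]
  have hc2 : c 2 = 0 := by
    rw [hx] at hx'
    rcases mul_eq_zero.mp hx'.symm with h | h
    · exact h
    · exact absurd h (dot_w_ne_zero b v u w hb hv hu hdet)
  refine ⟨c 0, c 1, ?_⟩
  rw [hxc, vecMul_rowMat, hc2, zero_smul, add_zero]

/-- Coordinates with respect to `(v, u)` are unique (`(v; u; w)` unimodular). -/
theorem perp_coords_unique (v u w : Fin 3 → ℤ) (hdet : IsUnit (rowMat v u w).det) (p q p' q' : ℤ)
    (h : p • v + q • u = p' • v + q' • u) : p = p' ∧ q = q' := by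
  have h0 : (![p - p', q - q', 0] : Fin 3 → ℤ) ᵥ* rowMat v u w = 0 := by
    rw [vecMul_rowMat]
    have e : (p - p') • v + (q - q') • u = (p • v + q • u) - (p' • v + q' • u) := by
      rw [sub_smul, sub_smul]; abel
    simp only [Matrix.cons_val_zero, Matrix.cons_val_one, Matrix.cons_val_two, Matrix.head_cons, Matrix.tail_cons,
      zero_smul, add_zero]
    rw [e, h, sub_self]
  have h1 : (![p - p', q - q', 0] : Fin 3 → ℤ) = 0 := by
    have := congrArg (fun y => y ᵥ* (rowMat v u w)⁻¹) h0
    simpa only [Matrix.vecMul_vecMul, Matrix.mul_nonsing_inv _ hdet, Matrix.vecMul_one, Matrix.zero_vecMul] using this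
  have e0 := congrFun h1 0
  have e1 := congrFun h1 1
  simp at e0 e1
  exact ⟨sub_eq_zero.mp e0, sub_eq_zero.mp e1⟩

/-- The index characterisation: with `A v = a • v + N' • u`, an element `p • v + q • u` of `b^⊥ ∩ ℤ³` lies in the sublattice
`ℤ v + ℤ (A v)` iff `N' ∣ q`.  Hence `[ℤv ⊕ ℤu : ℤv + ℤAv] = [ℤ² : ℤ × N'ℤ] = |N'|`. -/
theorem mem_span_iff_dvd (v u w : Fin 3 → ℤ) (hdet : IsUnit (rowMat v u w).det)
    (A : Matrix (Fin 3) (Fin 3) ℤ) (a N' : ℤ) (hA : A *ᵥ v = a • v + N' • u) (p q : ℤ) :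
    (∃ m n : ℤ, p • v + q • u = m • v + n • (A *ᵥ v)) ↔ N' ∣ q := by
  constructor
  · rintro ⟨m, n, h⟩
    rw [hA, smul_add, smul_smul, smul_smul, ← add_assoc, ← add_smul] at h
    obtain ⟨-, hq⟩ := perp_coords_unique v u w hdet p q (m + n * a) (n * N') h
    exact ⟨n, by rw [hq, mul_comm]⟩
  · rintro ⟨n, hn⟩
    refine ⟨p - n * a, n, ?_⟩
    rw [hA, hn, smul_add, smul_smul, smul_smul, ← add_assoc, ← add_smul, sub_add_cancel, mul_comm]

/-- Everything an `index_<tuple>` certificate of the staged tables gives, in general: `(v, u)` is a `ℤ`-basis of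
`b^⊥ ∩ ℤ³` (existence and uniqueness of coordinates) and `⟨v, Av⟩` corresponds to `ℤ × N'ℤ ⊂ ℤ²`, of index `|N'|`. -/
theorem index_certificate (b v u w : Fin 3 → ℤ) (A : Matrix (Fin 3) (Fin 3) ℤ) (a N' : ℤ)
    (hb : b ≠ 0) (hv : b ⬝ᵥ v = 0) (hu : b ⬝ᵥ u = 0)
    (hdet : (rowMat v u w).det = 1 ∨ (rowMat v u w).det = -1)
    (hA : A *ᵥ v = a • v + N' • u) :
    (∀ x : Fin 3 → ℤ, b ⬝ᵥ x = 0 → ∃ p q : ℤ, x = p • v + q • u) ∧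
    (∀ p q p' q' : ℤ, p • v + q • u = p' • v + q' • u → p = p' ∧ q = q') ∧
    (∀ p q : ℤ, (∃ m n : ℤ, p • v + q • u = m • v + n • (A *ᵥ v)) ↔ N' ∣ q) := by
  have hunit : IsUnit (rowMat v u w).det := by
    rcases hdet with h | h <;> rw [h]
    · exact isUnit_one
    · exact isUnit_one.neg
  exact ⟨fun x hx => perp_coords b v u w hb hv hu hunit x hx,
    fun p q p' q' h => perp_coords_unique v u w hunit p q p' q' h,
    fun p q => mem_span_iff_dvd v u w hunit A a N' hA p q⟩

/-! ### 2. The index as a relative index of subgroups of `ℤ³` (Mathlib's `AddSubgroup.relIndex`) -/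

/-- `b^⊥ ∩ ℤ³` as an additive subgroup of `ℤ³`. -/
def perp (b : Fin 3 → ℤ) : AddSubgroup (Fin 3 → ℤ) where
  carrier := {x | b ⬝ᵥ x = 0}
  add_mem' := by
    intro x y hx hy
    simp only [Set.mem_setOf_eq] at hx hy ⊢
    rw [dotProduct_add, hx, hy, add_zero]
  zero_mem' := by simp
  neg_mem' := by
    intro x hx
    simp only [Set.mem_setOf_eq] at hx ⊢
    rw [dotProduct_neg, hx, neg_zero]

/-- Membership in `perp b` is the equation `b ⬝ x = 0` (definitional). -/
theorem mem_perp {b x : Fin 3 → ℤ} : x ∈ perp b ↔ b ⬝ᵥ x = 0 := Iff.rfl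

/-- Coordinates of `p • v + q • u` with respect to the rows of `(v; u; w)`. -/
theorem coords_combo (v u w : Fin 3 → ℤ) (hdet : IsUnit (rowMat v u w).det) (p q : ℤ) :
    (p • v + q • u) ᵥ* (rowMat v u w)⁻¹ = ![p, q, 0] := by
  have h : (![p, q, 0] : Fin 3 → ℤ) ᵥ* rowMat v u w = p • v + q • u := by
    rw [vecMul_rowMat]
    simp only [Matrix.cons_val_zero, Matrix.cons_val_one, Matrix.cons_val_two, Matrix.head_cons, Matrix.tail_cons,
      zero_smul, add_zero]
  rw [← h, Matrix.vecMul_vecMul, Matrix.mul_nonsing_inv _ hdet, Matrix.vecMul_one]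

/-- With `b ≠ 0`, `b ⬝ v = b ⬝ u = 0`, `(v; u; w)` unimodular and `A v = a • v + N' • u`, the relative index of the
sublattice `⟨v, A v⟩` in `b^⊥ ∩ ℤ³` — Mathlib's `AddSubgroup.relIndex` — is `|N'|` (for `N' = 0` both sides are `0`,
Mathlib's value for infinite index).  Proof: the second coordinate `x ↦ q(x) mod |N'|` is a surjective homomorphism
`b^⊥ ∩ ℤ³ → ℤ/|N'|` whose kernel is `⟨v, A v⟩` (by `perp_coords`, `coords_combo`, `mem_span_iff_dvd`). -/
theorem relIndex_closure_pair (b v u w : Fin 3 → ℤ) (A : Matrix (Fin 3) (Fin 3) ℤ) (a N' : ℤ)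
    (hb : b ≠ 0) (hv : b ⬝ᵥ v = 0) (hu : b ⬝ᵥ u = 0) (hdet : IsUnit (rowMat v u w).det)
    (hA : A *ᵥ v = a • v + N' • u) :
    (AddSubgroup.closure ({v, A *ᵥ v} : Set (Fin 3 → ℤ))).relIndex (perp b) = N'.natAbs := by
  classical
  let f : perp b →+ ZMod N'.natAbs := AddMonoidHom.mk'
    (fun x => ((((x : Fin 3 → ℤ) ᵥ* (rowMat v u w)⁻¹) 1 : ℤ) : ZMod N'.natAbs))
    (by
      intro x y
      simp only [AddSubgroup.coe_add, Matrix.add_vecMul, Pi.add_apply, Int.cast_add])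
  have hf : ∀ x : perp b, f x = ((((x : Fin 3 → ℤ) ᵥ* (rowMat v u w)⁻¹) 1 : ℤ) : ZMod N'.natAbs) := fun x => rfl
  have hker : (AddSubgroup.closure ({v, A *ᵥ v} : Set (Fin 3 → ℤ))).addSubgroupOf (perp b) = f.ker := by
    ext x
    obtain ⟨p, q, hpq⟩ := perp_coords b v u w hb hv hu hdet x x.2
    rw [AddSubgroup.mem_addSubgroupOf, AddMonoidHom.mem_ker, hf, hpq, coords_combo v u w hdet,
      AddSubgroup.mem_closure_pair]
    simp only [Matrix.cons_val_one, Matrix.cons_val_zero]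
    rw [ZMod.intCast_zmod_eq_zero_iff_dvd, Int.natAbs_dvd, ← mem_span_iff_dvd v u w hdet A a N' hA p q]
    constructor
    · rintro ⟨m, k, h⟩; exact ⟨m, k, h.symm⟩
    · rintro ⟨m, k, h⟩; exact ⟨m, k, h.symm⟩
  have hsurj : Function.Surjective f := by
    intro z
    obtain ⟨k, rfl⟩ := ZMod.intCast_surjective z
    refine ⟨⟨k • u, ?_⟩, ?_⟩
    · rw [mem_perp, dotProduct_smul, hu, smul_zero]
    · rw [hf]
      show ((((k • u : Fin 3 → ℤ)) ᵥ* (rowMat v u w)⁻¹) 1 : ZMod N'.natAbs) = (k : ZMod N'.natAbs)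
      rw [show (k • u : Fin 3 → ℤ) = (0 : ℤ) • v + k • u by rw [zero_smul, zero_add], coords_combo v u w hdet]
      simp only [Matrix.cons_val_one, Matrix.cons_val_zero]
  show ((AddSubgroup.closure ({v, A *ᵥ v} : Set (Fin 3 → ℤ))).addSubgroupOf (perp b)).index = N'.natAbs
  rw [hker, AddSubgroup.index_ker, AddMonoidHom.range_eq_top.mpr hsurj, AddSubgroup.card_top, Nat.card_zmod]

/-- (Packaged under the hypotheses of an `index_` certificate, `det = ±1`.) -/
theorem index_eq_natAbs (b v u w : Fin 3 → ℤ) (A : Matrix (Fin 3) (Fin 3) ℤ) (a N' : ℤ)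
    (hb : b ≠ 0) (hv : b ⬝ᵥ v = 0) (hu : b ⬝ᵥ u = 0)
    (hdet : (rowMat v u w).det = 1 ∨ (rowMat v u w).det = -1)
    (hA : A *ᵥ v = a • v + N' • u) :
    (AddSubgroup.closure ({v, A *ᵥ v} : Set (Fin 3 → ℤ))).relIndex (perp b) = N'.natAbs := by
  have hunit : IsUnit (rowMat v u w).det := by
    rcases hdet with h | h <;> rw [h]
    · exact isUnit_one
    · exact isUnit_one.neg
  exact relIndex_closure_pair b v u w A a N' hb hv hu hunit hA

/-! ### 3. The sixteen instances: Table U and the index-3 presentations -/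

/-- Row `(104,141,70)` of Table U, column `N` (theorem `index_104_141_70`): for the torus `b = (1, 27, 2)` and host `A' = !![1892, 48425, 179; -74, -1894, -7; 19, 486, 2]` of the companion module
`CappellShanesonTorusSurgeryTablePart3.lean` (data verbatim from there: `v = (664, -26, 19)`, `u = (281, -11, 8)`, `w = (1, 0, 0)`, `A'v = -2·v + 7·u`), the index
`[b^⊥ ∩ ℤ³ : ⟨v, A'v⟩]` IS `7` — Mathlib's `relIndex` of the subgroup generated by `v, A'v` in `b^⊥ ∩ ℤ³`. [new] -/
theorem relIndex_104_141_70 :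
    (AddSubgroup.closure ({![(664 : ℤ), -26, 19], (!![1892, 48425, 179; -74, -1894, -7; 19, 486, 2] : Matrix (Fin 3) (Fin 3) ℤ) *ᵥ ![664, -26, 19]} :
        Set (Fin 3 → ℤ))).relIndex (perp ![(1 : ℤ), 27, 2]) = 7 :=
  (index_eq_natAbs ![(1 : ℤ), 27, 2] ![(664 : ℤ), -26, 19] ![(281 : ℤ), -11, 8] ![(1 : ℤ), 0, 0]
      !![1892, 48425, 179; -74, -1894, -7; 19, 486, 2] (-2) (7)
      (by intro h; simpa using congrFun h 0) (by decide) (by decide) (Or.inl (by simp [rowMat, Matrix.det_fin_three])) (by decide)).trans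
    (by decide)

/-- Row `(37,155,70)` of Table U, column `N` (theorem `index_37_155_70`): for the torus `b = (1, -7, 2)` and host `A' = !![-602, 4489, -52; -81, 604, -7; -16, 119, -1]` of the companion module
`CappellShanesonTorusSurgeryTablePart3.lean` (data verbatim from there: `v = (321, 43, -10)`, `u = (97, 13, -3)`, `w = (1, 0, 0)`, `A'v = -6·v + 23·u`), the index
`[b^⊥ ∩ ℤ³ : ⟨v, A'v⟩]` IS `23` — Mathlib's `relIndex` of the subgroup generated by `v, A'v` in `b^⊥ ∩ ℤ³`. [new] -/
theorem relIndex_37_155_70 :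
    (AddSubgroup.closure ({![(321 : ℤ), 43, -10], (!![-602, 4489, -52; -81, 604, -7; -16, 119, -1] : Matrix (Fin 3) (Fin 3) ℤ) *ᵥ ![321, 43, -10]} :
        Set (Fin 3 → ℤ))).relIndex (perp ![(1 : ℤ), -7, 2]) = 23 :=
  (index_eq_natAbs ![(1 : ℤ), -7, 2] ![(321 : ℤ), 43, -10] ![(97 : ℤ), 13, -3] ![(1 : ℤ), 0, 0]
      !![-602, 4489, -52; -81, 604, -7; -16, 119, -1] (-6) (23)
      (by intro h; simpa using congrFun h 0) (by decide) (by decide) (Or.inl (by simp [rowMat, Matrix.det_fin_three])) (by decide)).trans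
    (by decide)

/-- Row `(23,145,73)` of Table U, column `N` (theorem `index_23_145_73`): for the torus `b = (2, -15, 5)` and host `A' = !![-654, 5076, -557; -88, 683, -75; -29, 225, -25]` of the companion module
`CappellShanesonTorusSurgeryTablePart3.lean` (data verbatim from there: `v = (150, 19, -3)`, `u = (55, 7, -1)`, `w = (-7, -1, 0)`, `A'v = -1·v + 3·u`), the index
`[b^⊥ ∩ ℤ³ : ⟨v, A'v⟩]` IS `3` — Mathlib's `relIndex` of the subgroup generated by `v, A'v` in `b^⊥ ∩ ℤ³`. [new] -/
theorem relIndex_23_145_73 :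
    (AddSubgroup.closure ({![(150 : ℤ), 19, -3], (!![-654, 5076, -557; -88, 683, -75; -29, 225, -25] : Matrix (Fin 3) (Fin 3) ℤ) *ᵥ ![150, 19, -3]} :
        Set (Fin 3 → ℤ))).relIndex (perp ![(2 : ℤ), -15, 5]) = 3 :=
  (index_eq_natAbs ![(2 : ℤ), -15, 5] ![(150 : ℤ), 19, -3] ![(55 : ℤ), 7, -1] ![(-7 : ℤ), -1, 0]
      !![-654, 5076, -557; -88, 683, -75; -29, 225, -25] (-1) (3)
      (by intro h; simpa using congrFun h 0) (by decide) (by decide) (Or.inl (by simp [rowMat, Matrix.det_fin_three])) (by decide)).trans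
    (by decide)

/-- Row `(23,171,73)` of Table U, column `N` (theorem `index_23_171_73`): for the torus `b = (0, 2, 15)` and host `A' = !![0, -7, -62; 0, -1, -9; 1, -6, 5]` of the companion module
`CappellShanesonTorusSurgeryTablePart3.lean` (data verbatim from there: `v = (498, 75, -10)`, `u = (199, 30, -4)`, `w = (0, -7, 1)`, `A'v = -9·v + 23·u`), the index
`[b^⊥ ∩ ℤ³ : ⟨v, A'v⟩]` IS `23` — Mathlib's `relIndex` of the subgroup generated by `v, A'v` in `b^⊥ ∩ ℤ³`. [new] -/
theorem relIndex_23_171_73 :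
    (AddSubgroup.closure ({![(498 : ℤ), 75, -10], (!![0, -7, -62; 0, -1, -9; 1, -6, 5] : Matrix (Fin 3) (Fin 3) ℤ) *ᵥ ![498, 75, -10]} :
        Set (Fin 3 → ℤ))).relIndex (perp ![(0 : ℤ), 2, 15]) = 23 :=
  (index_eq_natAbs ![(0 : ℤ), 2, 15] ![(498 : ℤ), 75, -10] ![(199 : ℤ), 30, -4] ![(0 : ℤ), -7, 1]
      !![0, -7, -62; 0, -1, -9; 1, -6, 5] (-9) (23)
      (by intro h; simpa using congrFun h 1) (by decide) (by decide) (Or.inl (by simp [rowMat, Matrix.det_fin_three])) (by decide)).trans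
    (by decide)

/-- Row `(41,189,73)` of Table U, column `N` (theorem `index_41_189_73`): for the torus `b = (0, 3, 14)` and host `A' = !![0, -7, -48; 0, -1, -7; 1, -6, 4]` of the companion module
`CappellShanesonTorusSurgeryTablePart3.lean` (data verbatim from there: `v = (189, 28, -6)`, `u = (94, 14, -3)`, `w = (0, 5, -1)`, `A'v = -2·v + 5·u`), the index
`[b^⊥ ∩ ℤ³ : ⟨v, A'v⟩]` IS `5` — Mathlib's `relIndex` of the subgroup generated by `v, A'v` in `b^⊥ ∩ ℤ³`. [new] -/
theorem relIndex_41_189_73 :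
    (AddSubgroup.closure ({![(189 : ℤ), 28, -6], (!![0, -7, -48; 0, -1, -7; 1, -6, 4] : Matrix (Fin 3) (Fin 3) ℤ) *ᵥ ![189, 28, -6]} :
        Set (Fin 3 → ℤ))).relIndex (perp ![(0 : ℤ), 3, 14]) = 5 :=
  (index_eq_natAbs ![(0 : ℤ), 3, 14] ![(189 : ℤ), 28, -6] ![(94 : ℤ), 14, -3] ![(0 : ℤ), 5, -1]
      !![0, -7, -48; 0, -1, -7; 1, -6, 4] (-2) (5)
      (by intro h; simpa using congrFun h 1) (by decide) (by decide) (Or.inl (by simp [rowMat, Matrix.det_fin_three])) (by decide)).trans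
    (by decide)

/-- Row `(101,163,75)` of Table U, column `N` (theorem `index_101_163_75`): for the torus `b = (1, 18, 3)` and host `A' = !![1226, 20395, 978; -74, -1231, -59; 13, 216, 10]` of the companion module
`CappellShanesonTorusSurgeryTablePart3.lean` (data verbatim from there: `v = (339, -21, 13)`, `u = (-129, 8, -5)`, `w = (1, 0, 0)`, `A'v = 2·v + 5·u`), the index
`[b^⊥ ∩ ℤ³ : ⟨v, A'v⟩]` IS `5` — Mathlib's `relIndex` of the subgroup generated by `v, A'v` in `b^⊥ ∩ ℤ³`. [new] -/
theorem relIndex_101_163_75 :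
    (AddSubgroup.closure ({![(339 : ℤ), -21, 13], (!![1226, 20395, 978; -74, -1231, -59; 13, 216, 10] : Matrix (Fin 3) (Fin 3) ℤ) *ᵥ ![339, -21, 13]} :
        Set (Fin 3 → ℤ))).relIndex (perp ![(1 : ℤ), 18, 3]) = 5 :=
  (index_eq_natAbs ![(1 : ℤ), 18, 3] ![(339 : ℤ), -21, 13] ![(-129 : ℤ), 8, -5] ![(1 : ℤ), 0, 0]
      !![1226, 20395, 978; -74, -1231, -59; 13, 216, 10] (2) (5)
      (by intro h; simpa using congrFun h 0) (by decide) (by decide) (Or.inl (by simp [rowMat, Matrix.det_fin_three])) (by decide)).trans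
    (by decide)

/-- Row `(31,197,75)` of Table U, column `N` (theorem `index_31_197_75`): for the torus `b = (1, -7, -3)` and host `A' = !![406, -2639, 72; 62, -403, 11; 15, -98, 2]` of the companion module
`CappellShanesonTorusSurgeryTablePart3.lean` (data verbatim from there: `v = (301, 46, -7)`, `u = (-85, -13, 2)`, `w = (1, 0, 0)`, `A'v = 3·v + 7·u`), the index
`[b^⊥ ∩ ℤ³ : ⟨v, A'v⟩]` IS `7` — Mathlib's `relIndex` of the subgroup generated by `v, A'v` in `b^⊥ ∩ ℤ³`. [new] -/
theorem relIndex_31_197_75 :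
    (AddSubgroup.closure ({![(301 : ℤ), 46, -7], (!![406, -2639, 72; 62, -403, 11; 15, -98, 2] : Matrix (Fin 3) (Fin 3) ℤ) *ᵥ ![301, 46, -7]} :
        Set (Fin 3 → ℤ))).relIndex (perp ![(1 : ℤ), -7, -3]) = 7 :=
  (index_eq_natAbs ![(1 : ℤ), -7, -3] ![(301 : ℤ), 46, -7] ![(-85 : ℤ), -13, 2] ![(1 : ℤ), 0, 0]
      !![406, -2639, 72; 62, -403, 11; 15, -98, 2] (3) (7)
      (by intro h; simpa using congrFun h 0) (by decide) (by decide) (Or.inl (by simp [rowMat, Matrix.det_fin_three])) (by decide)).trans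
    (by decide)

/-- Row `(116,141,76)` of Table U (base trace `t = -65`), column `N` (theorem `index_116_141_neg65`): for the torus `b = (0, 5, 6)` and host `A' = !![0, 16181, 19150; 0, -109, -129; 1, 290, 167]` of the companion module
`CappellShanesonTorusSurgeryTablePart3.lean` (data verbatim from there: `v = (1795, -12, 10)`, `u = (-897, 6, -5)`, `w = (0, -1, 1)`, `A'v = 19·v + 41·u`), the index
`[b^⊥ ∩ ℤ³ : ⟨v, A'v⟩]` IS `41` — Mathlib's `relIndex` of the subgroup generated by `v, A'v` in `b^⊥ ∩ ℤ³`. [new] -/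
theorem relIndex_116_141_neg65 :
    (AddSubgroup.closure ({![(1795 : ℤ), -12, 10], (!![0, 16181, 19150; 0, -109, -129; 1, 290, 167] : Matrix (Fin 3) (Fin 3) ℤ) *ᵥ ![1795, -12, 10]} :
        Set (Fin 3 → ℤ))).relIndex (perp ![(0 : ℤ), 5, 6]) = 41 :=
  (index_eq_natAbs ![(0 : ℤ), 5, 6] ![(1795 : ℤ), -12, 10] ![(-897 : ℤ), 6, -5] ![(0 : ℤ), -1, 1]
      !![0, 16181, 19150; 0, -109, -129; 1, 290, 167] (19) (41)
      (by intro h; simpa using congrFun h 1) (by decide) (by decide) (Or.inl (by simp [rowMat, Matrix.det_fin_three])) (by decide)).trans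
    (by decide)

/-- Row `(98,153,76)` of Table U (base trace `t = -77`), column `N` (theorem `index_98_153_neg77`): for the torus `b = (0, 2, 3)` and host `A' = !![0, 2455, 3013; 0, -22, -27; 1, 138, 32]` of the companion module
`CappellShanesonTorusSurgeryTablePart3.lean` (data verbatim from there: `v = (342, -3, 2)`, `u = (1, 0, 0)`, `w = (0, -1, 1)`, `A'v = -4·v + 29·u`), the index
`[b^⊥ ∩ ℤ³ : ⟨v, A'v⟩]` IS `29` — Mathlib's `relIndex` of the subgroup generated by `v, A'v` in `b^⊥ ∩ ℤ³`. [new] -/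
theorem relIndex_98_153_neg77 :
    (AddSubgroup.closure ({![(342 : ℤ), -3, 2], (!![0, 2455, 3013; 0, -22, -27; 1, 138, 32] : Matrix (Fin 3) (Fin 3) ℤ) *ᵥ ![342, -3, 2]} :
        Set (Fin 3 → ℤ))).relIndex (perp ![(0 : ℤ), 2, 3]) = 29 :=
  (index_eq_natAbs ![(0 : ℤ), 2, 3] ![(342 : ℤ), -3, 2] ![(1 : ℤ), 0, 0] ![(0 : ℤ), -1, 1]
      !![0, 2455, 3013; 0, -22, -27; 1, 138, 32] (-4) (29)
      (by intro h; simpa using congrFun h 1) (by decide) (by decide) (Or.inl (by simp [rowMat, Matrix.det_fin_three])) (by decide)).trans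
    (by decide)

/-- Row `(34,145,77)` of Table U, column `N` (theorem `index_34_145_77`): for the torus `b = (1, -10, -2)` and host `A' = !![650, -6175, 86; 68, -646, 9; 21, -200, 3]` of the companion module
`CappellShanesonTorusSurgeryTablePart3.lean` (data verbatim from there: `v = (210, 22, -5)`, `u = (86, 9, -2)`, `w = (-1, 0, -1)`, `A'v = -1·v + 5·u`), the index
`[b^⊥ ∩ ℤ³ : ⟨v, A'v⟩]` IS `5` — Mathlib's `relIndex` of the subgroup generated by `v, A'v` in `b^⊥ ∩ ℤ³`. [new] -/
theorem relIndex_34_145_77 :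
    (AddSubgroup.closure ({![(210 : ℤ), 22, -5], (!![650, -6175, 86; 68, -646, 9; 21, -200, 3] : Matrix (Fin 3) (Fin 3) ℤ) *ᵥ ![210, 22, -5]} :
        Set (Fin 3 → ℤ))).relIndex (perp ![(1 : ℤ), -10, -2]) = 5 :=
  (index_eq_natAbs ![(1 : ℤ), -10, -2] ![(210 : ℤ), 22, -5] ![(86 : ℤ), 9, -2] ![(-1 : ℤ), 0, -1]
      !![650, -6175, 86; 68, -646, 9; 21, -200, 3] (-1) (5)
      (by intro h; simpa using congrFun h 0) (by decide) (by decide) (Or.inl (by simp [rowMat, Matrix.det_fin_three])) (by decide)).trans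
    (by decide)

/-- Row `(61,253,77)` of Table U, column `N` (theorem `index_61_253_77`): for the torus `b = (2, -7, 3)` and host `A' = !![-1708, 6195, -1662; -480, 1741, -467; -27, 98, -26]` of the companion module
`CappellShanesonTorusSurgeryTablePart3.lean` (data verbatim from there: `v = (112, 29, -7)`, `u = (-31, -8, 2)`, `w = (-3, -1, 0)`, `A'v = -2·v + -7·u`), the index
`[b^⊥ ∩ ℤ³ : ⟨v, A'v⟩]` IS `7` — Mathlib's `relIndex` of the subgroup generated by `v, A'v` in `b^⊥ ∩ ℤ³`. [new] -/
theorem relIndex_61_253_77 :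
    (AddSubgroup.closure ({![(112 : ℤ), 29, -7], (!![-1708, 6195, -1662; -480, 1741, -467; -27, 98, -26] : Matrix (Fin 3) (Fin 3) ℤ) *ᵥ ![112, 29, -7]} :
        Set (Fin 3 → ℤ))).relIndex (perp ![(2 : ℤ), -7, 3]) = 7 :=
  (index_eq_natAbs ![(2 : ℤ), -7, 3] ![(112 : ℤ), 29, -7] ![(-31 : ℤ), -8, 2] ![(-3 : ℤ), -1, 0]
      !![-1708, 6195, -1662; -480, 1741, -467; -27, 98, -26] (-2) (-7)
      (by intro h; simpa using congrFun h 0) (by decide) (by decide) (Or.inl (by simp [rowMat, Matrix.det_fin_three])) (by decide)).trans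
    (by decide)

/-- Index-3 presentation `indexI3_104_141_70` of Remark [Torus surgery] / `EXTENSIONS.md` Table 14B: for the torus `b = (3, 79, 5)` and host `A' = !![4986, 128639, 4705; -195, -5031, -184; 49, 1264, 46]` of the companion module
`CappellShanesonTorusSurgeryTablePart3.lean` (data verbatim from there: `v = (477, -19, 14)`, `u = (-176, 7, -5)`, `w = (-26, 1, 0)`, `A'v = -1·v + -3·u`), the index
`[b^⊥ ∩ ℤ³ : ⟨v, A'v⟩]` IS `3` — Mathlib's `relIndex` of the subgroup generated by `v, A'v` in `b^⊥ ∩ ℤ³`. [new] -/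
theorem relIndex_I3_104_141_70 :
    (AddSubgroup.closure ({![(477 : ℤ), -19, 14], (!![4986, 128639, 4705; -195, -5031, -184; 49, 1264, 46] : Matrix (Fin 3) (Fin 3) ℤ) *ᵥ ![477, -19, 14]} :
        Set (Fin 3 → ℤ))).relIndex (perp ![(3 : ℤ), 79, 5]) = 3 :=
  (index_eq_natAbs ![(3 : ℤ), 79, 5] ![(477 : ℤ), -19, 14] ![(-176 : ℤ), 7, -5] ![(-26 : ℤ), 1, 0]
      !![4986, 128639, 4705; -195, -5031, -184; 49, 1264, 46] (-1) (-3)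
      (by intro h; simpa using congrFun h 0) (by decide) (by decide) (Or.inr (by simp [rowMat, Matrix.det_fin_three])) (by decide)).trans
    (by decide)

/-- Index-3 presentation `indexI3_41_189_73` of Remark [Torus surgery] / `EXTENSIONS.md` Table 14B: for the torus `b = (1, -3, 18)` and host `A' = !![-72, 485, -56; -11, 74, -9; -1, 6, -4]` of the companion module
`CappellShanesonTorusSurgeryTablePart3.lean` (data verbatim from there: `v = (-255, -37, 8)`, `u = (-96, -14, 3)`, `w = (1, 0, 0)`, `A'v = -1·v + 3·u`), the index
`[b^⊥ ∩ ℤ³ : ⟨v, A'v⟩]` IS `3` — Mathlib's `relIndex` of the subgroup generated by `v, A'v` in `b^⊥ ∩ ℤ³`. [new] -/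
theorem relIndex_I3_41_189_73 :
    (AddSubgroup.closure ({![(-255 : ℤ), -37, 8], (!![-72, 485, -56; -11, 74, -9; -1, 6, -4] : Matrix (Fin 3) (Fin 3) ℤ) *ᵥ ![-255, -37, 8]} :
        Set (Fin 3 → ℤ))).relIndex (perp ![(1 : ℤ), -3, 18]) = 3 :=
  (index_eq_natAbs ![(1 : ℤ), -3, 18] ![(-255 : ℤ), -37, 8] ![(-96 : ℤ), -14, 3] ![(1 : ℤ), 0, 0]
      !![-72, 485, -56; -11, 74, -9; -1, 6, -4] (-1) (3)
      (by intro h; simpa using congrFun h 0) (by decide) (by decide) (Or.inl (by simp [rowMat, Matrix.det_fin_three])) (by decide)).trans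
    (by decide)

/-- Index-3 presentation `indexI3_116_141_neg65` of Remark [Torus surgery] / `EXTENSIONS.md` Table 14B: for the torus `b = (3, 292, -188)` and host `A' = !![-891, -103943, 34906; 6, 700, -235; -5, -584, 195]` of the companion module
`CappellShanesonTorusSurgeryTablePart3.lean` (data verbatim from there: `v = (12180, -82, 67)`, `u = (4904, -33, 27)`, `w = (-97, 1, 0)`, `A'v = 2·v + -3·u`), the index
`[b^⊥ ∩ ℤ³ : ⟨v, A'v⟩]` IS `3` — Mathlib's `relIndex` of the subgroup generated by `v, A'v` in `b^⊥ ∩ ℤ³`. [new] -/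
theorem relIndex_I3_116_141_neg65 :
    (AddSubgroup.closure ({![(12180 : ℤ), -82, 67], (!![-891, -103943, 34906; 6, 700, -235; -5, -584, 195] : Matrix (Fin 3) (Fin 3) ℤ) *ᵥ ![12180, -82, 67]} :
        Set (Fin 3 → ℤ))).relIndex (perp ![(3 : ℤ), 292, -188]) = 3 :=
  (index_eq_natAbs ![(3 : ℤ), 292, -188] ![(12180 : ℤ), -82, 67] ![(4904 : ℤ), -33, 27] ![(-97 : ℤ), 1, 0]
      !![-891, -103943, 34906; 6, 700, -235; -5, -584, 195] (2) (-3)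
      (by intro h; simpa using congrFun h 0) (by decide) (by decide) (Or.inr (by simp [rowMat, Matrix.det_fin_three])) (by decide)).trans
    (by decide)

/-- Index-3 presentation `indexI3_34_145_neg68` of Remark [Torus surgery] / `EXTENSIONS.md` Table 14B: for the torus `b = (3, 73, 5)` and host `A' = !![5556, 134399, 5861; -237, -5733, -250; 169, 4088, 178]` of the companion module
`CappellShanesonTorusSurgeryTablePart3.lean` (data verbatim from there: `v = (-407, 17, -4)`, `u = (120, -5, 1)`, `w = (-24, 1, 0)`, `A'v = -1·v + -3·u`), the index
`[b^⊥ ∩ ℤ³ : ⟨v, A'v⟩]` IS `3` — Mathlib's `relIndex` of the subgroup generated by `v, A'v` in `b^⊥ ∩ ℤ³`. [new] -/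
theorem relIndex_I3_34_145_neg68 :
    (AddSubgroup.closure ({![(-407 : ℤ), 17, -4], (!![5556, 134399, 5861; -237, -5733, -250; 169, 4088, 178] : Matrix (Fin 3) (Fin 3) ℤ) *ᵥ ![-407, 17, -4]} :
        Set (Fin 3 → ℤ))).relIndex (perp ![(3 : ℤ), 73, 5]) = 3 :=
  (index_eq_natAbs ![(3 : ℤ), 73, 5] ![(-407 : ℤ), 17, -4] ![(120 : ℤ), -5, 1] ![(-24 : ℤ), 1, 0]
      !![5556, 134399, 5861; -237, -5733, -250; 169, 4088, 178] (-1) (-3)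
      (by intro h; simpa using congrFun h 0) (by decide) (by decide) (Or.inr (by simp [rowMat, Matrix.det_fin_three])) (by decide)).trans
    (by decide)

/-- Index-3 presentation `indexI3_37_155_70` of Remark [Torus surgery] / `EXTENSIONS.md` Table 14B: for the torus `b = (2, -7, 34)` and host `A' = !![-104, 639, -616; -14, 86, -83; -3, 14, -35]` of the companion module
`CappellShanesonTorusSurgeryTablePart3.lean` (data verbatim from there: `v = (-641, -86, 20)`, `u = (-224, -30, 7)`, `w = (-3, -1, 0)`, `A'v = 2·v + -3·u`), the index
`[b^⊥ ∩ ℤ³ : ⟨v, A'v⟩]` IS `3` — Mathlib's `relIndex` of the subgroup generated by `v, A'v` in `b^⊥ ∩ ℤ³`. [new] -/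
theorem relIndex_I3_37_155_70 :
    (AddSubgroup.closure ({![(-641 : ℤ), -86, 20], (!![-104, 639, -616; -14, 86, -83; -3, 14, -35] : Matrix (Fin 3) (Fin 3) ℤ) *ᵥ ![-641, -86, 20]} :
        Set (Fin 3 → ℤ))).relIndex (perp ![(2 : ℤ), -7, 34]) = 3 :=
  (index_eq_natAbs ![(2 : ℤ), -7, 34] ![(-641 : ℤ), -86, 20] ![(-224 : ℤ), -30, 7] ![(-3 : ℤ), -1, 0]
      !![-104, 639, -616; -14, 86, -83; -3, 14, -35] (2) (-3)
      (by intro h; simpa using congrFun h 0) (by decide) (by decide) (Or.inr (by simp [rowMat, Matrix.det_fin_three])) (by decide)).trans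
    (by decide)

end Summit.SmoothPoincare4.GompfChains.CappellShanesonSurgeryIndex
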